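import Literature.AlgebraicGeometry.Motives.MixedHodgeStructureCatDualWeightTruncation
import Literature.AlgebraicGeometry.Motives.MixedHodgeStructureCatWeightTruncation
import HarnessLib

/-!
# Duality reverses the weight subquotients: `(W_{[a,b]} X)^∨ ≅ W_{[-b,-a]}(X^∨)`, in particular `(Gr^W_k X)^∨ ≅ Gr^W_{-k}(X^∨)`, functorially

Layer `Literature/AlgebraicGeometry/Motives` (lane `lit-hodgefound`), the categorical dictionary of mixed Hodge structures, continuing
`Motives/MixedHodgeStructureCatDualWeightTruncation` (`dualWeightQuotIso k X : (X ∕ W_k X)^∨ ≅ W_{-k-1}(X^∨)`,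
`weightQuotDualIso k X : X^∨ ∕ W_{-k-1}(X^∨) ≅ (W_k X)^∨`) and `Motives/MixedHodgeStructureCatWeightTruncation` (the weight truncations
`weightTrunc a b = W_b ∕ W_{a-1}`, `weightTruncπ a b : W_b ⟶ W_{[a,b]}`, the comparison `weightTruncComm a b : W_b ⋙ (− ∕ W_{a-1}) ≅ (− ∕ W_{a-1}) ⋙ W_b`,
and `weightTruncSelfIso k : W_{[k,k]} ≅ Gr^W_k`).  For the dual mixed Hodge structure (`W_r(X^∨) = (W_{-r-1} X)^⊥`: Deligne 1.1.6–1.1.7,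
Fujiki (1.6.2) a), Cattani–El Zein–Griffiths–Lê §3.2.2.7) the weight subquotients are exchanged with `[a, b] ↦ [-b, -a]`:

* §1 the index isomorphisms `weightFunctorCongr (h : i = j) : W_i ≅ W_j` (inclusions both ways — NOT `eqToIso`, so that underlying vectors compute)
  and finiteness of `W_{[a,b]} X`;
* §2 **`dualWeightTruncIso a b X : (W_{[a,b]} X)^∨ ≅ W_{[-b,-a]}(X^∨)`**, the composite
  `(W_b X ∕ W_{a-1})^∨ ≅ W_{-a}((W_b X)^∨) ≅ W_{-a}(X^∨ ∕ W_{-b-1}) ≅ W_{-a}(X^∨) ∕ W_{-b-1}`; it is CHARACTERISED by the commutative square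
  `(W_{-a} X^∨ ↠ W_{[-b,-a]} X^∨) ≫ (≅)⁻¹ ≫ (W_b X ↠ W_{[a,b]} X)^∨ = (W_{-a} X^∨ ↪ X^∨) ≫ (W_b X ↪ X)^∨` (a form `ψ` on `X` killing `W_{a-1} X`
  goes to the form `[w] ↦ ψ(w)` on `W_b X ∕ W_{a-1}`), and it is NATURAL in `X`:
  `(W_{[a,b]} f)^∨ ≫ (≅)_X = (≅)_Y ≫ W_{[-b,-a]}(f^∨)`;
* §3 **`dualGrWIso k X : (W_{[k,k]} X)^∨ ≅ Gr^W_{-k}(X^∨)`** (`= (gr (-k) ⋙ ofPure (-k)).obj X^∨`; with `weightTruncSelfIso k : W_{[k,k]} ≅ Gr^W_k`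
  this is «`(Gr^W_k X)^∨ ≅ Gr^W_{-k}(X^∨)`», El Zein §II.0.2 / the tree's unbundled `MixedHodgeStructure.dualGrHom`);
* §4 on the finite-dimensional full subcategory: `finWeightTrunc a b`, and the natural isomorphism
  **`dualWeightTruncNatIso a b : (finWeightTrunc a b).op ⋙ dualFunctor ≅ dualFunctor ⋙ finWeightTrunc (-b) (-a)`**.

Everything is PROVED; no named fact, no instance, no notation.

Sources, verbatim.  E. Cattani, F. El Zein, P. A. Griffiths, Lê D. T. (eds.), *Hodge Theory* (Princeton Math. Notes 49, 2014) [CattaniElZeinGriffithsLe2014],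
§3.2.2.7 p. 163 (`W_r Hom(H, H')`; «In particular, the dual `H^*` of a mixed Hodge structure `H` is an MHS»), §3.2.1.2 p. 152 (the two induced
filtrations on a subquotient), Def. 3.2.15, Lemma 3.2.20, Cor. 3.2.21.  P. Deligne, *Théorie de Hodge II* (1971) [DeligneHodgeII1971], 1.1.6–1.1.7,
1.1.11, Déf. 2.3.1 (`Gr^W_k = W_k ∕ W_{k-1}`).  A. Fujiki, *Duality of mixed Hodge structures of algebraic varieties*, Publ. RIMS 16 (1980) [Fujiki1980],
(1.6.2) a)–b).  F. El Zein, *Mixed Hodge structures*, Trans. AMS 275 (1983) [Elzein1983], §II.0.2 («`Gr^W_r H ≃ Hom(Gr^W_{-r} K, K')`» for the dual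
filtration) — through the tree's `Motives/MixedHodgeStructureDualGr`.  Category theory (`NatIso.ofComponents`, full subcategories) is Mathlib's [folklore].

## Main results

* §1 `weightFunctorCongr` (`_hom`, `_inv`, `coe_weightFunctorCongr_hom_app_apply`), `finite_weightTrunc_obj`.
* §2 **`dualWeightTruncIso`**, `dualWeightTruncIso_inv`, **`weightTruncπ_app_comp_dualWeightTruncIso_inv_comp_transposeHom_weightTruncπ_app`** (the
  characterising square), **`transposeHom_weightTrunc_map_comp_dualWeightTruncIso_hom`** (naturality), `dualWeightTruncIso_inv_naturality`.
* §3 **`dualGrWIso`** (`_hom`).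
* §4 `finWeightTrunc` (`_obj_obj`, `_map_hom`), **`dualWeightTruncNatIso`** (`_hom_app_hom`).

## References

* [CattaniElZeinGriffithsLe2014] E. Cattani et al. (eds.), Hodge Theory, Princeton Math. Notes 49 (2014), §3.2.1.2, §3.2.2.7, Def. 3.2.15, Lemma 3.2.20, Cor. 3.2.21.
* [DeligneHodgeII1971] P. Deligne, Théorie de Hodge II, Publ. Math. IHÉS 40 (1971), 1.1.6–1.1.7, 1.1.11, Déf. 2.3.1.
* [Fujiki1980] A. Fujiki, Duality of mixed Hodge structures of algebraic varieties, Publ. RIMS 16 (1980), (1.6.2).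
* [Elzein1983] F. El Zein, Mixed Hodge structures, Trans. Amer. Math. Soc. 275 (1983), §II.0.2.

## Provenance

Lane `lit-hodgefound` (summit `HodgeConjecture`), seat `lit-hodgefound-p36` (literature-prover, generation 47, row g47-#9).
-/

noncomputable section

open CategoryTheory Opposite

namespace Literature.AlgebraicGeometry.Motives

universe u

namespace MixedHodgeStructureCat

open MixedHodgeStructure (SubMixedHodgeStructure)

/-! ## §1 Index isomorphisms `W_i ≅ W_j` for `i = j`; finiteness of `W_{[a,b]} X` -/

/-- **`W_i ≅ W_j` for `i = j`**, built from the inclusions `weightLE` in both directions (so that on vectors both directions are the identity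
`by rfl`, unlike `eqToIso`). [cite: CattaniElZeinGriffithsLe2014, Def. 3.2.15] -/
def weightFunctorCongr {i j : ℤ} (h : i = j) : weightFunctor.{u} i ≅ weightFunctor.{u} j where
  hom := weightLE h.le
  inv := weightLE h.ge
  hom_inv_id := (weightLE_comp_weightLE _ _).trans (weightLE_refl i)
  inv_hom_id := (weightLE_comp_weightLE _ _).trans (weightLE_refl j)

/-- Unfolding `weightFunctorCongr` (hom). [cite: CattaniElZeinGriffithsLe2014, Def. 3.2.15] -/
theorem weightFunctorCongr_hom {i j : ℤ} (h : i = j) : (weightFunctorCongr.{u} h).hom = weightLE h.le := rfl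

/-- Unfolding `weightFunctorCongr` (inv). [cite: CattaniElZeinGriffithsLe2014, Def. 3.2.15] -/
theorem weightFunctorCongr_inv {i j : ℤ} (h : i = j) : (weightFunctorCongr.{u} h).inv = weightLE h.ge := rfl

/-- On vectors `weightFunctorCongr` is the identity. [cite: CattaniElZeinGriffithsLe2014, Def. 3.2.15] -/
@[simp]
theorem coe_weightFunctorCongr_hom_app_apply {i j : ℤ} (h : i = j) (X : MixedHodgeStructureCat.{u}) (x : ↥(X.str.W i)) :
    Subtype.val (MixedHodgeStructure.Hom.toLinearMap ((weightFunctorCongr h).hom.app X) x) = (x : X) := rfl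

/-- `W_{[a,b]} X = W_b X ∕ W_{a-1}(W_b X)` is finite-dimensional when `X` is. [cite: CattaniElZeinGriffithsLe2014, Def. 3.2.15 and Lemma 3.2.20] -/
theorem finite_weightTrunc_obj (a b : ℤ) (X : MixedHodgeStructureCat.{u}) [Module.Finite ℚ X] : Module.Finite ℚ ((weightTrunc a b).obj X) :=
  haveI := finite_weightFunctor_obj b X
  finite_weightQuotFunctor_obj (a - 1) ((weightFunctor b).obj X)

/-! ## §2 `(W_{[a,b]} X)^∨ ≅ W_{[-b,-a]}(X^∨)` -/

section Ambient

variable (a b k : ℤ) {X Y : MixedHodgeStructureCat.{u}} [Module.Finite ℚ X] [Module.Finite ℚ Y]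

variable (X) in
/-- **`(W_{[a,b]} X)^∨ ≅ W_{[-b,-a]}(X^∨)`** in `MixedHodgeStructureCat`: the composite of
`(W_b X ∕ W_{a-1}(W_b X))^∨ ≅ W_{-(a-1)-1}((W_b X)^∨)` (`dualWeightQuotIso (a-1)` at `W_b X`), `W_{-(a-1)-1} ≅ W_{-a}`,
`W_{-a}((W_b X)^∨) ≅ W_{-a}(X^∨ ∕ W_{-b-1}(X^∨))` (`W_{-a}` applied to `(weightQuotDualIso b X)⁻¹`) and
`W_{-a}(X^∨ ∕ W_{-b-1}) ≅ W_{-a}(X^∨) ∕ W_{-b-1}(W_{-a}(X^∨)) = W_{[-b,-a]}(X^∨)` (`(weightTruncComm (-b) (-a))⁻¹`).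
[cite: Fujiki1980, (1.6.2) a)–b)] [cite: CattaniElZeinGriffithsLe2014, §3.2.2.7 and §3.2.1.2] [cite: DeligneHodgeII1971, 1.1.6–1.1.7 and 1.1.11] -/
def dualWeightTruncIso :
    (haveI := finite_weightTrunc_obj a b X; of ((weightTrunc a b).obj X).str.dual) ≅ (weightTrunc (-b) (-a)).obj (of X.str.dual) :=
  haveI := finite_weightFunctor_obj b X
  dualWeightQuotIso (a - 1) ((weightFunctor b).obj X) ≪≫
    (weightFunctorCongr (show -(a - 1) - 1 = -a by ring)).app _ ≪≫
    (weightFunctor (-a)).mapIso (weightQuotDualIso b X).symm ≪≫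
    ((weightTruncComm (-b) (-a)).app (of X.str.dual)).symm

/-- Unfolding `(dualWeightTruncIso a b X)⁻¹` as the composite
`compare ≫ W_{-a}(weightQuotDualIso.hom) ≫ (W_{-a} ≅ W_{-(a-1)-1}) ≫ (dualWeightQuotIso (a-1) (W_b X))⁻¹` (by `rfl`). [cite: Fujiki1980, (1.6.2) b)] -/
theorem dualWeightTruncIso_inv :
    (dualWeightTruncIso a b X).inv =
      haveI := finite_weightFunctor_obj b X
      (((weightTruncComm (-b) (-a)).hom.app (of X.str.dual) ≫ (weightFunctor (-a)).map (weightQuotDualIso b X).hom) ≫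
        (weightFunctorCongr (show -(a - 1) - 1 = -a by ring)).inv.app _) ≫
        (dualWeightQuotIso (a - 1) ((weightFunctor b).obj X)).inv :=
  rfl

/-- **The characterising square** of `dualWeightTruncIso a b X`: a form `ψ ∈ W_{-a}(X^∨)` (a form on `X` killing `W_{a-1} X`) is sent by
`(≅)⁻¹ ∘ (W_{-a} X^∨ ↠ W_{[-b,-a]} X^∨)` to the form `[w] ↦ ψ(w)` on `W_{[a,b]} X = W_b X ∕ W_{a-1}`; i.e.
`(W_{-a} X^∨ ↠ W_{[-b,-a]} X^∨) ≫ (≅)⁻¹ ≫ (W_b X ↠ W_{[a,b]} X)^∨ = (W_{-a} X^∨ ↪ X^∨) ≫ (W_b X ↪ X)^∨` as morphisms `W_{-a}(X^∨) ⟶ (W_b X)^∨`.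
Since `W_{-a} X^∨ ↠ W_{[-b,-a]} X^∨` is epi and `(W_b X ↠ W_{[a,b]} X)^∨` is mono, this determines the isomorphism.
[cite: Fujiki1980, (1.6.2) b)] [cite: CattaniElZeinGriffithsLe2014, §3.2.1.2 and §3.2.2.7] -/
theorem weightTruncπ_app_comp_dualWeightTruncIso_inv_comp_transposeHom_weightTruncπ_app :
    haveI := finite_weightFunctor_obj b X
    haveI := finite_weightTrunc_obj a b X
    (weightTruncπ (-b) (-a)).app (of X.str.dual) ≫ (dualWeightTruncIso a b X).inv ≫
        transposeHom (X := (weightFunctor b).obj X) (Y := (weightTrunc a b).obj X) ((weightTruncπ a b).app X) =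
      (weightι (-a)).app (of X.str.dual) ≫ transposeHom (X := (weightFunctor b).obj X) (Y := X) ((weightι b).app X) := by
  haveI := finite_weightFunctor_obj b X
  haveI := finite_weightTrunc_obj a b X
  have key : (dualWeightQuotIso (a - 1) ((weightFunctor b).obj X)).inv ≫
      transposeHom (X := (weightFunctor b).obj X) (Y := (weightTrunc a b).obj X) ((weightTruncπ a b).app X) =
        (weightι (-(a - 1) - 1)).app (of ((weightFunctor b).obj X).str.dual) :=
    dualWeightQuotIso_inv_comp_transpose_weightπ (a - 1)
  -- split off the last factor `(dualWeightQuotIso (a-1) (W_b X))⁻¹` of `(≅)⁻¹` (definitional unfolding, `dualWeightTruncIso_inv`)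
  have e : (weightTruncπ (-b) (-a)).app (of X.str.dual) ≫ (dualWeightTruncIso a b X).inv ≫
      transposeHom (X := (weightFunctor b).obj X) (Y := (weightTrunc a b).obj X) ((weightTruncπ a b).app X) =
      ((weightTruncπ (-b) (-a)).app (of X.str.dual) ≫ (weightTruncComm (-b) (-a)).hom.app (of X.str.dual) ≫
          (weightFunctor (-a)).map (weightQuotDualIso b X).hom ≫
          (weightFunctorCongr (show -(a - 1) - 1 = -a by ring)).inv.app (of ((weightFunctor b).obj X).str.dual)) ≫
        ((dualWeightQuotIso (a - 1) ((weightFunctor b).obj X)).inv ≫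
          transposeHom (X := (weightFunctor b).obj X) (Y := (weightTrunc a b).obj X) ((weightTruncπ a b).app X)) :=
    rfl
  refine e.trans ((congrArg (fun t => ((weightTruncπ (-b) (-a)).app (of X.str.dual) ≫
    (weightTruncComm (-b) (-a)).hom.app (of X.str.dual) ≫ (weightFunctor (-a)).map (weightQuotDualIso b X).hom ≫
    (weightFunctorCongr (show -(a - 1) - 1 = -a by ring)).inv.app (of ((weightFunctor b).obj X).str.dual)) ≫ t) key).trans ?_)
  exact hom_ext (LinearMap.ext fun ψ => LinearMap.ext fun w => rfl)

/-- **Naturality of `(W_{[a,b]} X)^∨ ≅ W_{[-b,-a]}(X^∨)`**: for `f : X ⟶ Y`, `(W_{[a,b]} f)^∨ ≫ (≅)_X = (≅)_Y ≫ W_{[-b,-a]}(f^∨)`.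
(Proof: test against the epi `W_{-a} Y^∨ ↠ W_{[-b,-a]} Y^∨` and the mono `(W_b X ↠ W_{[a,b]} X)^∨`; by the characterising squares both sides become
`(W_{-a} Y^∨ ↪ Y^∨) ≫ f^∨ ≫ (W_b X ↪ X)^∨`.) [cite: Fujiki1980, (1.6.2) b)] [cite: CattaniElZeinGriffithsLe2014, Lemma 3.2.20 and §3.2.2.7] -/
theorem dualWeightTruncIso_inv_naturality (f : X ⟶ Y) :
    haveI := finite_weightTrunc_obj a b X
    haveI := finite_weightTrunc_obj a b Y
    (weightTrunc (-b) (-a)).map (transposeHom f) ≫ (dualWeightTruncIso a b X).inv =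
      (dualWeightTruncIso a b Y).inv ≫ transposeHom ((weightTrunc a b).map f) := by
  haveI := finite_weightFunctor_obj b X
  haveI := finite_weightFunctor_obj b Y
  haveI := finite_weightTrunc_obj a b X
  haveI := finite_weightTrunc_obj a b Y
  haveI : Mono (transposeHom (X := (weightFunctor b).obj X) (Y := (weightTrunc a b).obj X) ((weightTruncπ a b).app X)) :=
    (mono_transposeHom_iff _).2 (epi_weightTruncπ_app a b X)
  haveI : Epi ((weightTruncπ (-b) (-a)).app (of Y.str.dual)) := epi_weightTruncπ_app (-b) (-a) _
  rw [← cancel_mono (transposeHom (X := (weightFunctor b).obj X) (Y := (weightTrunc a b).obj X) ((weightTruncπ a b).app X)),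
    ← cancel_epi ((weightTruncπ (-b) (-a)).app (of Y.str.dual)), Category.assoc, Category.assoc]
  -- left: π'_Y ≫ W_{[-b,-a]}(f^∨) ≫ (≅)_X⁻¹ ≫ (π_X)^∨ = W_{-a}(f^∨) ≫ π'_X ≫ (≅)_X⁻¹ ≫ (π_X)^∨ = W_{-a}(f^∨) ≫ ι ≫ (ι_b)^∨
  have hl : (weightTruncπ (-b) (-a)).app (of Y.str.dual) ≫ (weightTrunc (-b) (-a)).map (transposeHom f) ≫
      (dualWeightTruncIso a b X).inv ≫
        transposeHom (X := (weightFunctor b).obj X) (Y := (weightTrunc a b).obj X) ((weightTruncπ a b).app X) =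
      (weightFunctor (-a)).map (transposeHom f) ≫ (weightι (-a)).app (of X.str.dual) ≫
        transposeHom (X := (weightFunctor b).obj X) (Y := X) ((weightι b).app X) := by
    rw [← weightTruncπ_app_comp_dualWeightTruncIso_inv_comp_transposeHom_weightTruncπ_app a b (X := X),
      ← Category.assoc, ← Category.assoc ((weightFunctor (-a)).map (transposeHom f))]
    exact congrArg (· ≫ _) ((weightTruncπ (-b) (-a)).naturality (transposeHom f)).symm
  -- right: π'_Y ≫ (≅)_Y⁻¹ ≫ (W_{[a,b]} f)^∨ ≫ (π_X)^∨ = π'_Y ≫ (≅)_Y⁻¹ ≫ (π_Y)^∨ ≫ (W_b f)^∨ = ι ≫ (ι_b)^∨ ≫ (W_b f)^∨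
  have hsq : transposeHom ((weightTrunc a b).map f) ≫
      transposeHom (X := (weightFunctor b).obj X) (Y := (weightTrunc a b).obj X) ((weightTruncπ a b).app X) =
      transposeHom (X := (weightFunctor b).obj Y) (Y := (weightTrunc a b).obj Y) ((weightTruncπ a b).app Y) ≫
        transposeHom ((weightFunctor b).map f) :=
    hom_ext (LinearMap.ext fun φ => LinearMap.ext fun w => rfl)
  have hr : (weightTruncπ (-b) (-a)).app (of Y.str.dual) ≫ (dualWeightTruncIso a b Y).inv ≫
      transposeHom ((weightTrunc a b).map f) ≫
        transposeHom (X := (weightFunctor b).obj X) (Y := (weightTrunc a b).obj X) ((weightTruncπ a b).app X) =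
      (weightι (-a)).app (of Y.str.dual) ≫ transposeHom (X := (weightFunctor b).obj Y) (Y := Y) ((weightι b).app Y) ≫
        transposeHom ((weightFunctor b).map f) := by
    rw [hsq, ← Category.assoc ((dualWeightTruncIso a b Y).inv), ← Category.assoc ((weightTruncπ (-b) (-a)).app _),
      weightTruncπ_app_comp_dualWeightTruncIso_inv_comp_transposeHom_weightTruncπ_app a b (X := Y), Category.assoc]
  rw [hl, hr]
  exact hom_ext (LinearMap.ext fun ψ => LinearMap.ext fun w => rfl)

/-- **Naturality of `(W_{[a,b]} X)^∨ ≅ W_{[-b,-a]}(X^∨)`** (hom form): `(W_{[a,b]} f)^∨ ≫ (≅)_X = (≅)_Y ≫ W_{[-b,-a]}(f^∨)`.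
[cite: Fujiki1980, (1.6.2) b)] [cite: CattaniElZeinGriffithsLe2014, Lemma 3.2.20 and §3.2.2.7] -/
theorem transposeHom_weightTrunc_map_comp_dualWeightTruncIso_hom (f : X ⟶ Y) :
    haveI := finite_weightTrunc_obj a b X
    haveI := finite_weightTrunc_obj a b Y
    transposeHom ((weightTrunc a b).map f) ≫ (dualWeightTruncIso a b X).hom =
      (dualWeightTruncIso a b Y).hom ≫ (weightTrunc (-b) (-a)).map (transposeHom f) := by
  have h := (Iso.comp_inv_eq _).1 (dualWeightTruncIso_inv_naturality a b f)
  rw [Category.assoc] at h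
  exact ((Iso.eq_inv_comp _).1 h).symm

/-! ## §3 `(Gr^W_k X)^∨ ≅ Gr^W_{-k}(X^∨)` -/

variable (X) in
/-- **`(W_{[k,k]} X)^∨ ≅ Gr^W_{-k}(X^∨)`** (`W_{[k,k]} = Gr^W_k`, `weightTruncSelfIso`): duality negates the weights of the graded pieces —
«`Gr^W_r(H^*) ≃ (Gr^W_{-r} H)^*`». [cite: Elzein1983, §II.0.2] [cite: Fujiki1980, (1.6.2) a)] [cite: DeligneHodgeII1971, Déf. 2.3.1 and 1.1.6–1.1.7] -/
def dualGrWIso :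
    (haveI := finite_weightTrunc_obj k k X; of ((weightTrunc k k).obj X).str.dual) ≅ (gr (-k) ⋙ ofPure (-k)).obj (of X.str.dual) :=
  dualWeightTruncIso k k X ≪≫ (weightTruncSelfIso (-k)).app (of X.str.dual)

/-- Unfolding `dualGrWIso` (hom). [cite: Elzein1983, §II.0.2] -/
theorem dualGrWIso_hom :
    (dualGrWIso k X).hom = (dualWeightTruncIso k k X).hom ≫ weightTruncToGr (-k) (of X.str.dual) := rfl

/-- Naturality of `dualGrWIso`: `(W_{[k,k]} f)^∨ ≫ (≅)_X = (≅)_Y ≫ Gr^W_{-k}(f^∨)`. [cite: Elzein1983, §II.0.2] [cite: CattaniElZeinGriffithsLe2014, Cor. 3.2.21] -/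
theorem transposeHom_weightTrunc_map_comp_dualGrWIso_hom (f : X ⟶ Y) :
    haveI := finite_weightTrunc_obj k k X
    haveI := finite_weightTrunc_obj k k Y
    transposeHom ((weightTrunc k k).map f) ≫ (dualGrWIso k X).hom =
      (dualGrWIso k Y).hom ≫ (gr (-k) ⋙ ofPure (-k)).map (transposeHom f) := by
  rw [dualGrWIso_hom, dualGrWIso_hom, ← Category.assoc, transposeHom_weightTrunc_map_comp_dualWeightTruncIso_hom, Category.assoc,
    Category.assoc]
  exact congrArg (_ ≫ ·) ((weightTruncSelfIso (-k)).hom.naturality (transposeHom f))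

end Ambient

/-! ## §4 On `FinSubcategory`: `(W_{[a,b]} −)^∨ ≅ W_{[-b,-a]} ∘ (−)^∨` -/

section Fin

variable (a b : ℤ)

/-- **`W_{[a,b]}` on the finite-dimensional full subcategory** (`finWeightFunctor b ⋙ finWeightQuotFunctor (a - 1)`, mirroring `weightTrunc`).
[cite: CattaniElZeinGriffithsLe2014, Def. 3.2.15 and Lemma 3.2.20] -/
abbrev finWeightTrunc : FinSubcategory.{u} ⥤ FinSubcategory.{u} :=
  finWeightFunctor b ⋙ finWeightQuotFunctor (a - 1)

/-- Unfolding `finWeightTrunc` on objects. [cite: CattaniElZeinGriffithsLe2014, Def. 3.2.15] -/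
theorem finWeightTrunc_obj_obj (X : FinSubcategory.{u}) : ((finWeightTrunc a b).obj X).obj = (weightTrunc a b).obj X.obj := rfl

/-- Unfolding `finWeightTrunc` on morphisms. [cite: CattaniElZeinGriffithsLe2014, Lemma 3.2.20] -/
theorem finWeightTrunc_map_hom {X Y : FinSubcategory.{u}} (f : X ⟶ Y) : ((finWeightTrunc a b).map f).hom = (weightTrunc a b).map f.hom := rfl

/-- **`(W_{[a,b]} −)^∨ ≅ W_{[-b,-a]} ∘ (−)^∨`** as functors `FinSubcategoryᵒᵖ ⥤ FinSubcategory` (components `dualWeightTruncIso`).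
[cite: Fujiki1980, (1.6.2) a)–b)] [cite: CattaniElZeinGriffithsLe2014, §3.2.2.7] [cite: DeligneHodgeII1971, 1.1.6–1.1.7] -/
def dualWeightTruncNatIso : (finWeightTrunc.{u} a b).op ⋙ dualFunctor ≅ dualFunctor ⋙ finWeightTrunc (-b) (-a) :=
  NatIso.ofComponents
    (fun X =>
      haveI : Module.Finite ℚ X.unop.obj := X.unop.property
      isFinite.isoMk (dualWeightTruncIso a b X.unop.obj))
    (fun {X Y} f => by
      apply isFinite.hom_ext
      haveI : Module.Finite ℚ X.unop.obj := X.unop.property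
      haveI : Module.Finite ℚ Y.unop.obj := Y.unop.property
      exact transposeHom_weightTrunc_map_comp_dualWeightTruncIso_hom a b f.unop.hom)

/-- Components of `dualWeightTruncNatIso`. [cite: Fujiki1980, (1.6.2) b)] -/
theorem dualWeightTruncNatIso_hom_app_hom (X : FinSubcategory.{u}ᵒᵖ) :
    ((dualWeightTruncNatIso a b).hom.app X).hom =
      (haveI : Module.Finite ℚ X.unop.obj := X.unop.property; (dualWeightTruncIso a b X.unop.obj).hom) := rfl

end Fin

end MixedHodgeStructureCat

end Literature.AlgebraicGeometry.Motives
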